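import Summits.BirchSwinnertonDyer.BirchSwinnertonDyer.Theorems.AdditiveBranchIMCGordTwoRankZeroTransport
import Summits.BirchSwinnertonDyer.Rank1Residual.Additive.CycLeadingTermDvdConverse
import Summits.BirchSwinnertonDyer.Rank1Residual.Additive.SemistableTwistAnalytic
import HarnessLib

/-!
# Crux `GordTwoRankZeroOffCaseOne` (route `AdditiveBranchIMC`, item 19357) is EXACTLY the `T = 0`
# main-conjecture lower bound on its rows — `iff`s from the route's named facts (sequel of
# `AdditiveBranchIMCGordTwoRankZeroTransport`)

Cell `bsd-addord`, seat `bsd-addord-k1-c2` (D-0074 row B1). HONEST FRAMING: nothing here proves the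
Birch–Swinnerton-Dyer conjecture or the crux; every published input is an explicit named-fact binder of
the route (`PrintedFacts`: Delbourgo 1998 Prop. 4 divisibility form `hDel`, Gross–Zagier–Kolyvagin `hGZK`,
modularity `hmod`, modular parametrisation `hmodD`; `ReadingFacts`: Delbourgo 1998 Prop. 4 exact intrinsic
form `hDelG`; and Pal 2012 Thm. 3.2 `hPal` for the even branch); nothing is asserted, nothing booked.

The transport file proved SUFFICIENCY: the `T = 0` lower input `CycLowerLeadingTermAt W p` (for every
generator `f` of `char_Λ X(E/ℚ_∞)`, `L(E,1)/Ω_E ∣ f(0)` in `ℤ_p`) gives the lower half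
`ord_p #Ш(E)_an ≤ ord_p #Ш(E)` on the additive (G)-ordinary locus in analytic rank `0`. This file proves
NECESSITY from the same printed facts, so that the crux — and the cell conjecture `N10.LowerHalfGordTwo` —
are, in the kernel, EXACTLY the `T = 0` shadow of Delbourgo's Main Conjecture (G) in the `⊆ (𝓛)`
direction on their rows (equivalently, on the `I₀*` cell, the `T = 0` value of the Skinner–Urban
containment on the `ω^{(p−1)/2}`-branch of the good ordinary twist `E♭`, by Birch–Pal): the crux
conjectures NOTHING beyond that input and nothing less. Mechanism of the converse (tree theorem
`cycLeadingTermDvdAt_of_missingLowerBoundAt`, b2b seat p18, stated for `TypeGOrd ∨ ord_p j < 0`):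
`ord_p g(0) ≥ ord_p #Ш + ord_p ∏_{ν≠p} c_ν − 2 ord_p #E(ℚ) ≥ ord_p (L(E,1)/Ω_E) − ord_p c_p` by Delbourgo's
divisibility and the lower half, and `ord_p c_p(E) = 0` on the cell (`c_p ∈ {1,2,4}` on `I₀*`, tree
theorem `TypeGOrd.not_dvd_tamagawaNumberAt_of_semistabilityIndex_eq_two`; `c_p ≤ 4 < p` on the
`e ∈ {3,4,6}` corner, `padicValNat_tamagawaNumberAt_eq_zero_of_addv`).

* §1 `missingLowerBoundAt_iff_cycLowerLeadingTermAt_of_typeGOrd` (additive (G)-ordinary, odd `p`,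
  `r_an = 0`, `p ∤ c_p`), `…_cellGordTwo` (`I₀*`: `p ∤ c_p` automatic), `…_cellGordHigher` (`p ≥ 5`
  automatic on the corner);
* §2 the branch currencies on the `I₀*` cell: `MissingLowerBoundAt W p ↔ ChiBranchLowerLeadingTermAt W p`
  (`p ≡ 1 (mod 4)`) resp. `↔ ChiBranchLowerLeadingTermOddAt W p` (`p ≡ 3 (mod 4)`, `p = 3` included);
* §3 crux / stub / cell level: `gordTwoRankZeroOffCaseOne_iff_forall_cycLowerLeadingTerm` — from the named
  facts, `GordTwoRankZeroOffCaseOne ↔ (∀ off-Case-1 pairs of the cell in rank 0, CycLowerLeadingTermAt W p)`;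
  the same for the two registered stubs' statements and for `N10.LowerHalfGordTwo` /
  `N10.LowerHalfGordHigher` (the rank-0 rows of the residual crux `GordHigherLower`).

References: D. Delbourgo, Compositio Math. 113 (1998) Prop. 4 (p. 144), Main Conjecture (p. 151)
[Delbourgo1998]; V. Pal, Proc. AMS 140 (2012) Thm. 3.2 [Pal2012]; J. H. Silverman, ATAEC IV.9 Table 4.1
(Kodaira–Néron, `c_p ≤ 4` at an additive prime) [SilvermanATAEC1994]; R. L. Miller, LMS J. Comput.
Math. 14 (2011) Def. 1.1 [Miller2011LMS]; C. Skinner, E. Urban, Invent. Math. 195 (2014) Thm. 3.6.4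
(shape of the branch input) [SkinnerUrban2014].
-/

set_option autoImplicit false
set_option linter.dupNamespace false

noncomputable section

open scoped Classical

open WeierstrassCurve NumberField IsDedekindDomain Rat.HeightOneSpectrum
  Literature.NumberTheory.EllipticCurves
  Literature.NumberTheory.EllipticCurves.ModularForms
  Literature.NumberTheory.EllipticCurves.Rank1Residual
  Literature.NumberTheory.EllipticCurves.Rank1Residual.Typed
  Literature.NumberTheory.GaloisRepresentations

namespace Summit.BirchSwinnertonDyer.BirchSwinnertonDyer.Theorems.AdditiveBranchIMCGordTwoRankZeroExact

open Summit.BirchSwinnertonDyer.Rank1Residual.Additive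
open Summit.BirchSwinnertonDyer.BirchSwinnertonDyer.Theses.AdditiveBranchIMC
open Summit.BirchSwinnertonDyer.BirchSwinnertonDyer.Theorems.AdditiveBranchIMCGordTwoRankZeroTransport

variable {W : WeierstrassCurve ℚ} [W.IsElliptic] [W.IsGloballyMinimal] {p : ℕ} [hp : Fact p.Prime]

/-! ## §1 The lower half ⟺ the `T = 0` lower input, on the additive (G)-ordinary locus in rank `0` -/

/-- **Additive (G)-ordinary, odd `p`, `r_an = 0`, `p ∤ c_p(E)`: `MissingLowerBoundAt W p ↔
CycLowerLeadingTermAt W p`.** (→) Delbourgo 1998 Prop. 4 divisibility form (`hDel`) + the lower half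
bound `ord_p (L(E,1)/Ω_E) ≤ ord_p g(0)` for every `g ∈ char_Λ X(E/ℚ_∞)` (tree theorem
`cycLeadingTermDvdAt_of_missingLowerBoundAt`) and principality (`cycLeadingTermDvdAt_iff_cycLowerLeadingTermAt`);
(←) the transport file (`hDelG`, exact intrinsic form). [cite: Delbourgo1998, Prop. 4 (p. 144) and Main Conjecture (p. 151)]
[cite: Miller2011LMS, Def. 1.1] -/
theorem missingLowerBoundAt_iff_cycLowerLeadingTermAt_of_typeGOrd
    (hDel : Delbourgo1998.prop4_rankZero_pow_dvd_constantCoeff)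
    (hDelG : Delbourgo1998.prop4_rankZero_constantCoeff_eq_unit_mul_of_potGoodOrd)
    (hGZK : rank_eq_analyticRank_of_analyticRank_le_one) (hmod : hasEntireLFunction_rat)
    (hp2 : p ≠ 2) (hadd : Addv W p) (hG : TypeGOrd W p) (hr : W.analyticRank = 0)
    (htam : ¬ p ∣ W.tamagawaNumberAt ((primesEquiv (R := 𝓞 ℚ)).symm ⟨p, hp.out⟩)) :
    MissingLowerBoundAt W p ↔ CycLowerLeadingTermAt W p :=
  ⟨fun hlow ↦ (cycLeadingTermDvdAt_iff_cycLowerLeadingTermAt W p).mp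
      (cycLeadingTermDvdAt_of_missingLowerBoundAt W p hDel hGZK hmod hp2 hadd (Or.inl hG) hr htam hlow),
    missingLowerBoundAt_rankZero_of_cycLowerLeadingTerm_of_typeGOrd hDelG hGZK hmod hp2 hadd hG hr⟩

/-- **Cell (G-ord, `e = 2`) (`I₀*`), `r_an = 0`: `MissingLowerBoundAt W p ↔ CycLowerLeadingTermAt W p`**
— `p ∤ c_p` is automatic (`c_p ∈ {1, 2, 4}`, tree theorem
`TypeGOrd.not_dvd_tamagawaNumberAt_of_semistabilityIndex_eq_two`). [cite: Delbourgo1998, Prop. 4 (p. 144)]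
[cite: Miller2011LMS, Def. 1.1] -/
theorem missingLowerBoundAt_iff_cycLowerLeadingTermAt_cellGordTwo
    (hDel : Delbourgo1998.prop4_rankZero_pow_dvd_constantCoeff)
    (hDelG : Delbourgo1998.prop4_rankZero_constantCoeff_eq_unit_mul_of_potGoodOrd)
    (hGZK : rank_eq_analyticRank_of_analyticRank_le_one) (hmod : hasEntireLFunction_rat)
    (hc : N10.CellGordTwo W p) (hr : W.analyticRank = 0) :
    MissingLowerBoundAt W p ↔ CycLowerLeadingTermAt W p :=
  missingLowerBoundAt_iff_cycLowerLeadingTermAt_of_typeGOrd hDel hDelG hGZK hmod hc.1 hc.2.1 hc.2.2.1 hr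
    (TypeGOrd.not_dvd_tamagawaNumberAt_of_semistabilityIndex_eq_two W p hc.1 hc.2.2.1 hc.2.1 hc.2.2.2)

/-- **Cell (G-ord, `e ∈ {3,4,6}`) (the corner of the residual crux `GordHigherLower`), `r_an = 0`:
`MissingLowerBoundAt W p ↔ CycLowerLeadingTermAt W p`** — `p ≥ 5` on the corner
(`N10.five_le_of_cellGordHigher`), so `p ∤ c_p ≤ 4` (`padicValNat_tamagawaNumberAt_eq_zero_of_addv`).
[cite: Delbourgo1998, Prop. 4 (p. 144)] [cite: SilvermanATAEC1994, IV.9 Table 4.1] [cite: Miller2011LMS, Def. 1.1] -/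
theorem missingLowerBoundAt_iff_cycLowerLeadingTermAt_cellGordHigher
    (hDel : Delbourgo1998.prop4_rankZero_pow_dvd_constantCoeff)
    (hDelG : Delbourgo1998.prop4_rankZero_constantCoeff_eq_unit_mul_of_potGoodOrd)
    (hGZK : rank_eq_analyticRank_of_analyticRank_le_one) (hmod : hasEntireLFunction_rat)
    (hc : N10.CellGordHigher W p) (hr : W.analyticRank = 0) :
    MissingLowerBoundAt W p ↔ CycLowerLeadingTermAt W p := by
  refine missingLowerBoundAt_iff_cycLowerLeadingTermAt_of_typeGOrd hDel hDelG hGZK hmod hc.1 hc.2.1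
    hc.2.2.1 hr ?_
  have hp5 : 5 ≤ p := N10.five_le_of_cellGordHigher W p hc
  have h0 := padicValNat_tamagawaNumberAt_eq_zero_of_addv W p hc.2.1 hp5
  obtain ⟨hne, -⟩ := tamagawaNumberAt_ne_zero_and_le_four_of_addv W p hc.2.1
  rcases padicValNat.eq_zero_iff.mp h0 with h1 | h1 | h1
  · exact absurd h1 hp.out.one_lt.ne'
  · exact absurd h1 hne
  · exact h1

/-! ## §2 The branch currencies on the `I₀*` cell -/

/-- **Cell (G-ord, `e = 2`), `p ≡ 1 (mod 4)`, `r_an = 0`: the lower half ⟺ the EVEN-branch `T = 0`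
input**, `MissingLowerBoundAt W p ↔ ChiBranchLowerLeadingTermAt W p` (for every good ordinary twist datum
`(V, f, ϖ)` and every `g ∈ char_Λ X(E/ℚ_∞)`, `g(0) ∈ (ϖ·∑_{a mod p}(a/p)[a/p]⁺_f)·ℤ_p`) — Birch + Pal
2012 Thm. 3.2 (`hPal`). [cite: Pal2012, Thm. 3.2] [cite: Delbourgo1998, Prop. 4 (p. 144)]
[cite: MazurTateTeitelbaum1986Invent, §I.8 (8.6)] [cite: Miller2011LMS, Def. 1.1] -/
theorem missingLowerBoundAt_iff_chiBranchLowerLeadingTermAt_cellGordTwo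
    (hDel : Delbourgo1998.prop4_rankZero_pow_dvd_constantCoeff)
    (hDelG : Delbourgo1998.prop4_rankZero_constantCoeff_eq_unit_mul_of_potGoodOrd)
    (hPal : Pal2012.thm32_sqrt_mul_realPeriodRat_twist_eq_of_prime_one_mod_four)
    (hGZK : rank_eq_analyticRank_of_analyticRank_le_one) (hmod : hasEntireLFunction_rat)
    (hmodD : nonempty_modularParametrizationData)
    (hc : N10.CellGordTwo W p) (hp4 : p % 4 = 1) (hr : W.analyticRank = 0) :
    MissingLowerBoundAt W p ↔ ChiBranchLowerLeadingTermAt W p :=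
  (missingLowerBoundAt_iff_cycLowerLeadingTermAt_cellGordTwo hDel hDelG hGZK hmod hc hr).trans
    (cycLowerLeadingTermAt_iff_chiBranchLower_of_typeGOrd_of_semistabilityIndex_eq_two W p hPal hmod hmodD
      hp4 hc.2.1 hc.2.2.1 hc.2.2.2)

/-- **Cell (G-ord, `e = 2`), `p ≡ 3 (mod 4)` (`p = 3` included), `r_an = 0`: the lower half ⟺ the
ODD-branch `T = 0` input**, `MissingLowerBoundAt W p ↔ ChiBranchLowerLeadingTermOddAt W p` (minus
symbols, `Ω⁻`). [cite: Pal2012, Thm. 3.2] [cite: Delbourgo1998, Prop. 4 (p. 144)] [cite: Miller2011LMS, Def. 1.1] -/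
theorem missingLowerBoundAt_iff_chiBranchLowerLeadingTermOddAt_cellGordTwo
    (hDel : Delbourgo1998.prop4_rankZero_pow_dvd_constantCoeff)
    (hDelG : Delbourgo1998.prop4_rankZero_constantCoeff_eq_unit_mul_of_potGoodOrd)
    (hGZK : rank_eq_analyticRank_of_analyticRank_le_one) (hmod : hasEntireLFunction_rat)
    (hmodD : nonempty_modularParametrizationData)
    (hc : N10.CellGordTwo W p) (hp4 : p % 4 = 3) (hr : W.analyticRank = 0) :
    MissingLowerBoundAt W p ↔ ChiBranchLowerLeadingTermOddAt W p :=
  (missingLowerBoundAt_iff_cycLowerLeadingTermAt_cellGordTwo hDel hDelG hGZK hmod hc hr).trans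
    (cycLowerLeadingTermAt_iff_chiBranchLowerOdd_of_typeGOrd_of_semistabilityIndex_eq_two W p hmod hmodD
      hp4 hc.2.1 hc.2.2.1 hc.2.2.2)

/-! ## §3 Crux, stubs and cell conjectures are EXACTLY the `T = 0` input on their rows -/

/-- **Crux 19357 ⟺ the `T = 0` main-conjecture lower bound on its rows**, from the named facts:
`GordTwoRankZeroOffCaseOne ↔ ∀ (E, p) in cell (G-ord, e = 2), r_an = 0, no Case-1 member,
CycLowerLeadingTermAt W p`. The crux conjectures nothing beyond (and nothing less than) the `⊆ (𝓛)`
direction of Delbourgo's Main Conjecture (G) at `T = 0` on those pairs. [cite: Delbourgo1998, Prop. 4 (p. 144) and Main Conjecture (p. 151)]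
[cite: Miller2011LMS, Def. 1.1] -/
theorem gordTwoRankZeroOffCaseOne_iff_forall_cycLowerLeadingTerm
    (hDel : Delbourgo1998.prop4_rankZero_pow_dvd_constantCoeff)
    (hDelG : Delbourgo1998.prop4_rankZero_constantCoeff_eq_unit_mul_of_potGoodOrd)
    (hGZK : rank_eq_analyticRank_of_analyticRank_le_one) (hmod : hasEntireLFunction_rat) :
    GordTwoRankZeroOffCaseOne ↔
      ∀ (W : WeierstrassCurve ℚ) [W.IsElliptic] [W.IsGloballyMinimal] (p : ℕ) [Fact p.Prime],
        W.analyticRank = 0 → N10.CellGordTwo W p → ¬ HasCaseOneMember W p → CycLowerLeadingTermAt W p :=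
  ⟨fun h W _ _ p _ hr hc hno ↦
      (missingLowerBoundAt_iff_cycLowerLeadingTermAt_cellGordTwo hDel hDelG hGZK hmod hc hr).mp
        (h W p hr hc hno),
    gordTwoRankZeroOffCaseOne_of_cycLowerLeadingTerm hDelG hGZK hmod⟩

/-- **With the route's facts packaged**: `PrintedFacts → ReadingFacts → (GordTwoRankZeroOffCaseOne ↔
∀ off-Case-1 rows, CycLowerLeadingTermAt)` (conjuncts used: `hDel`, `hGZK`, `hmod` of `PrintedFacts`,
`hDelG` of `ReadingFacts`). [cite: Delbourgo1998, Prop. 4 (p. 144)] [cite: Miller2011LMS, Def. 1.1] -/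
theorem gordTwoRankZeroOffCaseOne_iff_forall_cycLowerLeadingTerm_of_facts
    (hP : PrintedFacts) (hR : ReadingFacts) :
    GordTwoRankZeroOffCaseOne ↔
      ∀ (W : WeierstrassCurve ℚ) [W.IsElliptic] [W.IsGloballyMinimal] (p : ℕ) [Fact p.Prime],
        W.analyticRank = 0 → N10.CellGordTwo W p → ¬ HasCaseOneMember W p → CycLowerLeadingTermAt W p :=
  gordTwoRankZeroOffCaseOne_iff_forall_cycLowerLeadingTerm hP.2.2.2.1 hR.2.2.2.2 hP.2.2.2.2.1
    hP.2.2.2.2.2.1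

/-- **Registered stub `stub_irreducible` ⟺ the `T = 0` input on the irreducible rows** (from the named
facts). [cite: Delbourgo1998, Prop. 4 (p. 144)] [cite: Miller2011LMS, Def. 1.1] -/
theorem stubIrreducible_iff_forall_cycLowerLeadingTerm
    (hDel : Delbourgo1998.prop4_rankZero_pow_dvd_constantCoeff)
    (hDelG : Delbourgo1998.prop4_rankZero_constantCoeff_eq_unit_mul_of_potGoodOrd)
    (hGZK : rank_eq_analyticRank_of_analyticRank_le_one) (hmod : hasEntireLFunction_rat) :
    (∀ (W : WeierstrassCurve ℚ) [W.IsElliptic] [W.IsGloballyMinimal] (p : ℕ) [Fact p.Prime],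
      W.analyticRank = 0 → N10.CellGordTwo W p → W.HasIrreducibleModPGaloisRep p →
        MissingLowerBoundAt W p) ↔
    ∀ (W : WeierstrassCurve ℚ) [W.IsElliptic] [W.IsGloballyMinimal] (p : ℕ) [Fact p.Prime],
      W.analyticRank = 0 → N10.CellGordTwo W p → Irr W p → CycLowerLeadingTermAt W p :=
  ⟨fun h W _ _ p _ hr hc hirr ↦
      (missingLowerBoundAt_iff_cycLowerLeadingTermAt_cellGordTwo hDel hDelG hGZK hmod hc hr).mp
        (h W p hr hc hirr),
    stubIrreducible_of_cycLowerLeadingTerm hDelG hGZK hmod⟩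

/-- **Registered stub `stub_reducibleNoCaseOne` ⟺ the `T = 0` input on the reducible rows with no
Case-1 member** (from the named facts). [cite: Delbourgo1998, Prop. 4 (p. 144)] [cite: Miller2011LMS, Def. 1.1] -/
theorem stubReducibleNoCaseOne_iff_forall_cycLowerLeadingTerm
    (hDel : Delbourgo1998.prop4_rankZero_pow_dvd_constantCoeff)
    (hDelG : Delbourgo1998.prop4_rankZero_constantCoeff_eq_unit_mul_of_potGoodOrd)
    (hGZK : rank_eq_analyticRank_of_analyticRank_le_one) (hmod : hasEntireLFunction_rat) :
    (∀ (W : WeierstrassCurve ℚ) [W.IsElliptic] [W.IsGloballyMinimal] (p : ℕ) [Fact p.Prime],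
      W.analyticRank = 0 → N10.CellGordTwo W p → ¬ W.HasIrreducibleModPGaloisRep p →
        ¬ HasCaseOneMember W p → MissingLowerBoundAt W p) ↔
    ∀ (W : WeierstrassCurve ℚ) [W.IsElliptic] [W.IsGloballyMinimal] (p : ℕ) [Fact p.Prime],
      W.analyticRank = 0 → N10.CellGordTwo W p → ¬ Irr W p → ¬ HasCaseOneMember W p →
        CycLowerLeadingTermAt W p :=
  ⟨fun h W _ _ p _ hr hc hred hno ↦
      (missingLowerBoundAt_iff_cycLowerLeadingTermAt_cellGordTwo hDel hDelG hGZK hmod hc hr).mp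
        (h W p hr hc hred hno),
    stubReducibleNoCaseOne_of_cycLowerLeadingTerm hDelG hGZK hmod⟩

/-- **The cell conjecture `N10.LowerHalfGordTwo` ⟺ the `T = 0` input on every rank-0 pair of the `I₀*`
cell** (from the named facts). [cite: Delbourgo1998, Prop. 4 (p. 144) and Main Conjecture (p. 151)]
[cite: Miller2011LMS, Def. 1.1] -/
theorem lowerHalfGordTwo_iff_forall_cycLowerLeadingTerm
    (hDel : Delbourgo1998.prop4_rankZero_pow_dvd_constantCoeff)
    (hDelG : Delbourgo1998.prop4_rankZero_constantCoeff_eq_unit_mul_of_potGoodOrd)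
    (hGZK : rank_eq_analyticRank_of_analyticRank_le_one) (hmod : hasEntireLFunction_rat) :
    N10.LowerHalfGordTwo ↔
      ∀ (W : WeierstrassCurve ℚ) [W.IsElliptic] [W.IsGloballyMinimal] (p : ℕ) [Fact p.Prime],
        W.analyticRank = 0 → N10.CellGordTwo W p → CycLowerLeadingTermAt W p :=
  ⟨fun h W _ _ p _ hr hc ↦
      (missingLowerBoundAt_iff_cycLowerLeadingTermAt_cellGordTwo hDel hDelG hGZK hmod hc hr).mp (h W p hr hc),
    fun h W _ _ p _ hr hc ↦
      missingLowerBoundAt_cellGordTwo_rankZero_of_cycLowerLeadingTerm hDelG hGZK hmod hc hr (h W p hr hc)⟩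

/-- **The corner conjecture `N10.LowerHalfGordHigher` (rank-0 rows of the residual crux `GordHigherLower`)
⟺ the `T = 0` input on every rank-0 pair of the `e ∈ {3,4,6}` cell** (from the named facts): in rank `0`
the corner is no different from the `I₀*` cell once the `T = 0` input is displayed — what differs is
that there NO `p`-adic `L`-function of an elliptic curve interpolates `L(E,1)` (Delbourgo 1998 p. 150),
so the input has no branch reading. [cite: Delbourgo1998, Prop. 4 (p. 144), Main Conjecture (p. 151) and §1.5]
[cite: Miller2011LMS, Def. 1.1] -/
theorem lowerHalfGordHigher_iff_forall_cycLowerLeadingTerm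
    (hDel : Delbourgo1998.prop4_rankZero_pow_dvd_constantCoeff)
    (hDelG : Delbourgo1998.prop4_rankZero_constantCoeff_eq_unit_mul_of_potGoodOrd)
    (hGZK : rank_eq_analyticRank_of_analyticRank_le_one) (hmod : hasEntireLFunction_rat) :
    N10.LowerHalfGordHigher ↔
      ∀ (W : WeierstrassCurve ℚ) [W.IsElliptic] [W.IsGloballyMinimal] (p : ℕ) [Fact p.Prime],
        W.analyticRank = 0 → N10.CellGordHigher W p → CycLowerLeadingTermAt W p :=
  ⟨fun h W _ _ p _ hr hc ↦
      (missingLowerBoundAt_iff_cycLowerLeadingTermAt_cellGordHigher hDel hDelG hGZK hmod hc hr).mp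
        (h W p hr hc),
    fun h W _ _ p _ hr hc ↦
      missingLowerBoundAt_cellGordHigher_rankZero_of_cycLowerLeadingTerm hDelG hGZK hmod hc hr (h W p hr hc)⟩

end Summit.BirchSwinnertonDyer.BirchSwinnertonDyer.Theorems.AdditiveBranchIMCGordTwoRankZeroExact

end
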